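import Literature.AlgebraicGeometry.HodgeTheory.MonodromySemisimpleSubvariations
import Literature.AlgebraicGeometry.HodgeTheory.QbarFamilyLocalSystem
import Literature.AlgebraicGeometry.HodgeTheory.ClassesSupportedOnComplexification
import Literature.AlgebraicGeometry.HodgeTheory.HodgeStructureOfHodgeModel
import Literature.AlgebraicGeometry.HodgeTheory.HodgeFiltrationModelsReductionProofs
import Literature.AlgebraicGeometry.HodgeTheory.ComplexConjugationHolds
import Literature.AlgebraicGeometry.HodgeTheory.BettiUniverseAxioms
import Summits.HodgeConjecture.HodgeConjecture.Theorems.Q8SymplecticPowersTransportRestriction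
import Mathlib.RingTheory.Flat.Equalizer
import Mathlib.LinearAlgebra.TensorProduct.Pi
import HarnessLib

/-!
# Route `Q8SymplecticPowers`, crux K1Q «mechanism-v5» — glue S7, brick G3: the FINITE-ORBIT part `N ⊆ H²(X_t; ℚ)` consists of
# Hodge classes (theorem of the fixed part on the finite étale cover — Deligne 1987 Prop. 1.13 as the binder FACT B — and S4 (i))

Support file for crux K1Q (stmt-HodgeConjecture-24190; `--supports … --as helper`; nothing here closes an item). Prover seat
`hodge-nonav-19716-p2` (g14), owner of stub S7 `stub_transportHeredityQ`. Referee audit #36 (c) display obligation: the finite-orbit span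
`N := span {x | some finite-index Γ' ≤ Γ_t fixes x}` (registered text of S4 ∕ S5 ∕ S7) is the fixed space of ONE finite-index `Γ₀`
(`exists_finiteIndex_normal_span_fixed_iff`), i.e. the monodromy invariants of the finite-index `H₀ = ρ⁻¹Γ₀ ≤ π₁(S(ℂ), t)`; by FACT B
(`deligne1987_monodromy_directSum_irreducible_subvariations`, through lit's `isHodgeSubspace_transportInvariants`) these invariants form a
Hodge subspace of `H²(X_t(ℂ); ℂ)`; so the `(0,2)`-component of `v ⊗ 1`, `v ∈ N`, is again invariant, hence lies in `N ⊗ ℂ` (invariants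
commute with the flat base change `ℚ → ℂ`, §1), hence in `N_ℂ ∩ H^{0,2} = conj(N_ℂ ∩ H^{2,0}) = 0` by S4 (i); therefore `v ⊗ 1 ∈ F¹`:

* §1 `exists_finset_biInf_ker_eq`, `mem_baseChange_biInf_ker_of_forall` — invariants of a set of endomorphisms of a finite-dimensional
  space commute with extension of scalars (Artinian reduction to finitely many + `Module.Flat.ker_lTensor_eq`).
* §2 `ofRatClassBaseChange_baseChange_of_isRatTransport` — the comparison `ℂ ⊗_ℚ H² ≅ H²(X_t(ℂ); ℂ)` intertwines a rational transport with
  the transport; `conj_mem_baseChange` — `N ⊗ ℂ` is stable under complex conjugation.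
* §3 **`span_finiteIndexFixed_le_hodgeClasses_one`** — hypothesis (hgN)'s input of the restriction currency: `N ≤ Hdg¹(H²(X_t))`.

HONEST FRAMING: assembly of tree theorems, conditional exactly on FACT B (a binder of S7 v5); K1Q ∕ HC ∕ HC_AV NOT proved; item 24190 OPEN.

## References
* [Deligne1987] P. Deligne, Un théorème de finitude pour la monodromie, Progr. Math. 67 (1987), §1.11, Prop. 1.13.
* [DeligneHodgeII1971] P. Deligne, Théorie de Hodge II, Publ. Math. IHÉS 40 (1971), 4.1.1–4.1.2 (theorem of the fixed part).
* [CarlsonMullerStachPeters2017] J. Carlson, S. Müller-Stach, C. Peters, Period Mappings and Period Domains, 2nd ed., Lemma–Def. 15.3.7.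
-/

noncomputable section

set_option linter.dupNamespace false

namespace Summit.HodgeConjecture.HodgeConjecture.Theorems.Q8SymplecticPowersFiniteOrbitPartHodge

open CategoryTheory CategoryTheory.Limits AlgebraicGeometry
open Literature.AlgebraicGeometry.Motives Literature.AlgebraicGeometry.HodgeTheory
open Literature.AlgebraicGeometry.HodgeTheory.BettiUniverse
open Literature.AlgebraicTopology.SingularHomology
open Summit.HodgeConjecture.HodgeConjecture.Theorems.Q8SymplecticPowersTransportRestriction (exists_finiteIndex_normal_span_fixed_iff)
open scoped TensorProduct

/-! ### §1 Invariants commute with extension of scalars -/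

section BaseChange

variable {k : Type*} [Field k] {K : Type*} [Field K] [Algebra k K] {V : Type*} [AddCommGroup V] [Module k V]

/-- The common kernel of a set of endomorphisms of a finite-dimensional space is the common kernel of finitely many of them
(descending chain condition). [folklore] -/
theorem exists_finset_biInf_ker_eq [FiniteDimensional k V] (S : Set (Module.End k V)) :
    ∃ F : Finset (Module.End k V), ↑F ⊆ S ∧ ⨅ φ ∈ S, LinearMap.ker φ = ⨅ φ ∈ F, LinearMap.ker φ := by
  classical
  set 𝒜 : Set (Submodule k V) := {M | ∃ F : Finset (Module.End k V), ↑F ⊆ S ∧ M = ⨅ φ ∈ F, LinearMap.ker φ} with h𝒜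
  have hne : 𝒜.Nonempty := ⟨_, ∅, by simp, rfl⟩
  obtain ⟨M₀, ⟨F₀, hF₀S, rfl⟩, hmin⟩ := IsArtinian.set_has_minimal 𝒜 hne
  refine ⟨F₀, hF₀S, le_antisymm ?_ ?_⟩
  · exact biInf_mono hF₀S
  · refine le_iInf₂ fun φ hφ => ?_
    -- `M₀ ⊓ ker φ ∈ 𝒜` is not below `M₀`
    have hmem : (⨅ ψ ∈ insert φ F₀, LinearMap.ker ψ) ∈ 𝒜 :=
      ⟨insert φ F₀, by rw [Finset.coe_insert]; exact Set.insert_subset hφ hF₀S, rfl⟩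
    have hle : (⨅ ψ ∈ insert φ F₀, LinearMap.ker ψ) ≤ ⨅ ψ ∈ F₀, LinearMap.ker ψ :=
      biInf_mono (Finset.subset_insert φ F₀)
    have heq : (⨅ ψ ∈ insert φ F₀, LinearMap.ker ψ) = ⨅ ψ ∈ F₀, LinearMap.ker ψ :=
      (eq_or_lt_of_le hle).resolve_right (hmin _ hmem)
    rw [← heq]
    exact biInf_le _ (Finset.mem_insert_self φ F₀)

/-- **Invariants commute with extension of scalars**: a vector of `K ⊗_k V` killed by the base changes of all `φ ∈ S` lies in
`(⋂_{φ ∈ S} ker φ) ⊗_k K` (`V` finite-dimensional; reduce to finitely many `φ`, then flatness `Module.Flat.ker_lTensor_eq` for the single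
map `V → V^F`). [folklore] -/
theorem mem_baseChange_biInf_ker_of_forall [FiniteDimensional k V] (S : Set (Module.End k V)) {y : K ⊗[k] V}
    (hy : ∀ φ ∈ S, φ.baseChange K y = 0) : y ∈ (⨅ φ ∈ S, LinearMap.ker φ).baseChange K := by
  classical
  obtain ⟨F, hFS, hF⟩ := exists_finset_biInf_ker_eq (k := k) S
  rw [hF]
  -- one map `Φ : V → V^F` whose kernel is the finite intersection
  let Φ : V →ₗ[k] (↥F → V) := LinearMap.pi fun φ => (φ : Module.End k V)
  have hker : LinearMap.ker Φ = ⨅ φ ∈ F, LinearMap.ker φ := by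
    rw [LinearMap.ker_pi]
    apply le_antisymm
    · exact le_iInf₂ fun φ hφ => iInf_le (fun ψ : ↥F => LinearMap.ker (ψ : Module.End k V)) ⟨φ, hφ⟩
    · exact le_iInf fun ψ => biInf_le _ ψ.2
  rw [← hker]
  have hflat : LinearMap.ker (Φ.baseChange K) = (LinearMap.ker Φ).baseChange K := Module.Flat.ker_lTensor_eq K K Φ
  rw [← hflat, LinearMap.mem_ker]
  -- test `Φ_K y = 0` componentwise through `K ⊗ V^F ≃ (K ⊗ V)^F`
  apply (TensorProduct.piRight k K K (fun _ : ↥F => V)).injective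
  rw [map_zero]
  have hcomp : ∀ z : K ⊗[k] V, TensorProduct.piRight k K K (fun _ : ↥F => V) (Φ.baseChange K z) =
      fun ψ : ↥F => (ψ : Module.End k V).baseChange K z := by
    intro z
    induction z using TensorProduct.induction_on with
    | zero => simp only [map_zero]; rfl
    | tmul c v =>
      funext ψ
      rw [LinearMap.baseChange_tmul, TensorProduct.piRight_apply, TensorProduct.piRightHom_tmul, LinearMap.baseChange_tmul]
      rfl
    | add x x' hx hx' =>
      rw [map_add, map_add, hx, hx']
      funext ψ
      simp only [Pi.add_apply, map_add]
  rw [hcomp]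
  funext ψ
  exact hy _ (hFS ψ.2)

end BaseChange

/-! ### §2 The comparison `ℂ ⊗_ℚ H² ≅ H²(X_t(ℂ); ℂ)`: transports and complex conjugation -/

/-- **The comparison intertwines a rational transport with the transport**: `Θ(T_ℂ y) = γ_* Θ(y)` for `(T v) ⊗ 1 = γ_*(v ⊗ 1)`.
[cite: CarlsonMullerStachPeters2017, Lemma–Definition 15.3.7] -/
theorem ofRatClassBaseChange_baseChange_of_isRatTransport {𝒳 S : SchemeOver ℂ} (π : 𝒳 ⟶ S) (k : ℕ)
    {U : Set (ComplexPoints S)} (hU : IsCohomologicallyLocallyTrivialOn π U) {s s' : U} (γ : Path.Homotopic.Quotient s s')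
    {T : bettiCohomology (fiberOver π s.1) k ≃ₗ[ℚ] bettiCohomology (fiberOver π s'.1) k} (hT : IsRatTransport π k hU γ T)
    (y : ℂ ⊗[ℚ] bettiCohomology (fiberOver π s.1) k) :
    ofRatClassBaseChange _ k ((T : bettiCohomology (fiberOver π s.1) k →ₗ[ℚ] bettiCohomology (fiberOver π s'.1) k).baseChange ℂ y) =
      transportFun π k hU γ (ofRatClassBaseChange _ k y) := by
  induction y using TensorProduct.induction_on with
  | zero => rw [map_zero, map_zero, map_zero, ← transportLinear_apply, map_zero]
  | tmul c v =>
    rw [LinearMap.baseChange_tmul, ofRatClassBaseChange_tmul, ofRatClassBaseChange_tmul, LinearEquiv.coe_coe, hT v,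
      transportFun_smul]
  | add x x' hx hx' => rw [map_add, map_add, hx, hx', map_add, transportFun_add]

/-- `N ⊗ ℂ ⊆ ℂ ⊗_ℚ V` is stable under complex conjugation, for every rational subspace `N ≤ V`. [folklore] -/
theorem conj_mem_baseChange {V : Type*} [AddCommGroup V] [Module ℚ V] (N : Submodule ℚ V) {x : ℂ ⊗[ℚ] V}
    (hx : x ∈ N.baseChange ℂ) : HodgeStructure.conj x ∈ N.baseChange ℂ := by
  rw [Submodule.baseChange_eq_span] at hx ⊢
  induction hx using Submodule.span_induction with
  | mem y hy =>
    obtain ⟨v, hv, rfl⟩ := Submodule.mem_map.1 hy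
    change HodgeStructure.conj ((1 : ℂ) ⊗ₜ[ℚ] v) ∈ _
    rw [HodgeStructure.conj_tmul, map_one (starRingEnd ℂ)]
    exact Submodule.subset_span (Submodule.mem_map.2 ⟨v, hv, rfl⟩)
  | zero => rw [map_zero]; exact Submodule.zero_mem _
  | add y z _ _ hy hz => rw [map_add]; exact Submodule.add_mem _ hy hz
  | smul c y _ hy => rw [HodgeStructure.conj_smul]; exact Submodule.smul_mem _ _ hy

/-! ### §3 The finite-orbit part consists of Hodge classes -/

/-- **G3: `N ≤ Hdg¹(H²(X_t))`.** `π : 𝒳 ⟶ S` a smooth projective family of surfaces, `S` quasi-projective and smooth of pure dimension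
`d`, cohomologically locally trivial over `S(ℂ)` (`hU`), `t ∈ S(ℂ)`, `N` the registered finite-orbit span; hypotheses: FACT B
(`deligne1987_monodromy_directSum_irreducible_subvariations`) and S4 (i) `N_ℂ ∩ H^{2,0}(X_t) = 0`. Then every class of `N` is a Hodge
class of `H²(X_t)` (type `(1,1)`). [cite: Deligne1987, §1.11 and Prop. 1.13] [cite: DeligneHodgeII1971, 4.1.1–4.1.2] -/
theorem span_finiteIndexFixed_le_hodgeClasses_one {𝒳 S : SchemeOver ℂ} (π : 𝒳 ⟶ S) (hπ : IsSmoothProjectiveFamily π 2)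
    (hS : IsQuasiProjectiveOver S) (d : ℕ) [SmoothOfRelativeDimension d S.hom]
    (hU : IsCohomologicallyLocallyTrivialOn π (Set.univ : Set (ComplexPoints S))) (t : ComplexPoints S)
    (hB : deligne1987_monodromy_directSum_irreducible_subvariations)
    (hi : (Submodule.span ℚ {x : bettiCohomology (fiberOver π t) 2 |
        ∃ Γ' : Subgroup (bettiCohomology (fiberOver π t) 2 ≃ₗ[ℚ] bettiCohomology (fiberOver π t) 2),
          Γ' ≤ ratMonodromyGroup π 2 hU ⟨t, Set.mem_univ t⟩ ∧
          (Γ'.subgroupOf (ratMonodromyGroup π 2 hU ⟨t, Set.mem_univ t⟩)).FiniteIndex ∧ ∀ γ ∈ Γ', γ x = x}).baseChange ℂ ⊓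
        (hodge exists_isReal_hodgeModel_holds (hπ.isSmoothProjective t) 2).piece 2 0 = ⊥) :
    Submodule.span ℚ {x : bettiCohomology (fiberOver π t) 2 |
        ∃ Γ' : Subgroup (bettiCohomology (fiberOver π t) 2 ≃ₗ[ℚ] bettiCohomology (fiberOver π t) 2),
          Γ' ≤ ratMonodromyGroup π 2 hU ⟨t, Set.mem_univ t⟩ ∧
          (Γ'.subgroupOf (ratMonodromyGroup π 2 hU ⟨t, Set.mem_univ t⟩)).FiniteIndex ∧ ∀ γ ∈ Γ', γ x = x} ≤
      (hodge exists_isReal_hodgeModel_holds (hπ.isSmoothProjective t) 2).hodgeClasses 1 := by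
  classical
  have hXt : IsSmoothProjective 2 (fiberOver π t) := hπ.isSmoothProjective t
  haveI := finite hXt 2
  -- ### instances for Ehresmann (rational transports)
  haveI := hπ.smoothOfRelativeDimension
  haveI := hπ.isProper
  haveI : LocallyOfFiniteType S.hom := hS.locallyOfFiniteType
  haveI : IsSeparated S.hom := hS.isVarietyPair_ofScheme.isSeparated
  haveI : QuasiCompact S.hom := hS.isVarietyPair_ofScheme.quasiCompact
  haveI : CompactSpace S.left := QuasiCompact.compactSpace_of_compactSpace S.hom
  haveI : Smooth S.hom := SmoothOfRelativeDimension.smooth d S.hom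
  have hrat : ∀ (s s' : (Set.univ : Set (ComplexPoints S))) (γ : Path.Homotopic.Quotient s s')
      (α : complexBetti (fiberOver π s.1) 2), IsRationalClass α → IsRationalClass (transportFun π 2 hU γ α) :=
    fun s s' γ α hα => isRationalClass_transportFun_univ (f := π) (k := 2) 2 d γ hα
  -- ### names
  set Γ := ratMonodromyGroup π 2 hU ⟨t, Set.mem_univ t⟩ with hΓdef
  set N := Submodule.span ℚ {x : bettiCohomology (fiberOver π t) 2 |
        ∃ Γ' : Subgroup (bettiCohomology (fiberOver π t) 2 ≃ₗ[ℚ] bettiCohomology (fiberOver π t) 2),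
          Γ' ≤ Γ ∧ (Γ'.subgroupOf Γ).FiniteIndex ∧ ∀ γ ∈ Γ', γ x = x} with hNdef
  set Hs := hodge exists_isReal_hodgeModel_holds hXt 2 with hHs
  let A : HodgeModel 2 (fiberOver π t) := realHodgeModel exists_isReal_hodgeModel_holds hXt
  let ρ := ratMonodromyRep π 2 hU hrat ⟨t, Set.mem_univ t⟩
  have hrange : ρ.range = Γ := range_ratMonodromyRep π 2 hU hrat _
  -- ### `N = Fix(Γ₀)` for one finite-index `Γ₀ ≤ Γ`
  obtain ⟨Γ₀, hΓ₀le, hΓ₀fi, -, hΓ₀fix⟩ := exists_finiteIndex_normal_span_fixed_iff Γ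
  have hNfix : ∀ x, x ∈ N ↔ ∀ γ ∈ Γ₀, γ x = x := hΓ₀fix
  -- as a common kernel
  set Sφ : Set (Module.End ℚ (bettiCohomology (fiberOver π t) 2)) :=
    (fun g : bettiCohomology (fiberOver π t) 2 ≃ₗ[ℚ] bettiCohomology (fiberOver π t) 2 =>
      (g : Module.End ℚ (bettiCohomology (fiberOver π t) 2)) - 1) '' (Γ₀ : Set _) with hSφ
  have hNker : N = ⨅ φ ∈ Sφ, LinearMap.ker φ := by
    ext x
    rw [hNfix, Submodule.mem_iInf]
    simp only [Submodule.mem_iInf, hSφ, Set.forall_mem_image, SetLike.mem_coe, LinearMap.mem_ker, LinearMap.sub_apply,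
      Module.End.one_apply, sub_eq_zero, LinearEquiv.coe_coe]
  -- ### the finite-index subgroup of `π₁` and its invariants, a Hodge subspace (FACT B)
  set H₀ := Γ₀.comap ρ with hH₀
  have hH₀fi : H₀.FiniteIndex := finiteIndex_comap_ratMonodromyRep π 2 hU hrat _ hΓ₀fi
  set W := transportInvariants π 2 hU ⟨t, Set.mem_univ t⟩ H₀ with hW
  have hWH : IsHodgeSubspace 2 (fiberOver π t) 2 W :=
    hB.isHodgeSubspace_transportInvariants (f := π) (n := 2) (k := 2) (s := ⟨t, Set.mem_univ t⟩) (H := H₀) hπ hS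
      inferInstance hU hH₀fi
  -- ### the comparison `Θ`
  let Θ := ofRatClassBaseChangeEquiv hXt 2
  -- an element of `W` pulled back through `Θ` is fixed by `Γ₀`, hence lies in `N ⊗ ℂ`
  have hWN : ∀ c ∈ W, Θ.symm c ∈ N.baseChange ℂ := by
    intro c hc
    rw [hNker]
    refine mem_baseChange_biInf_ker_of_forall Sφ fun φ hφ => ?_
    obtain ⟨g, hg, rfl⟩ := hφ
    obtain ⟨γ, rfl⟩ : g ∈ ρ.range := by rw [hrange]; exact hΓ₀le hg
    have hγ : γ ∈ H₀ := Subgroup.mem_comap.2 hg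
    have hfix : transportFun π 2 hU (FundamentalGroup.toPath γ) c = c := (mem_transportInvariants_iff π 2 hU _ H₀ c).1 hc γ hγ
    rw [LinearMap.baseChange_sub, LinearMap.sub_apply, LinearMap.baseChange_one, Module.End.one_apply, sub_eq_zero]
    apply Θ.injective
    rw [ofRatClassBaseChangeEquiv_apply, ofRatClassBaseChange_baseChange_of_isRatTransport π 2 hU _ (ratMonodromyRep_isRatTransport π 2 hU hrat _ γ),
      ← ofRatClassBaseChangeEquiv_apply hXt, LinearEquiv.apply_symm_apply, hfix]
  -- ### the `(0,2)`-component of `v ⊗ 1`, `v ∈ N`, vanishes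
  intro v hv
  set c := ofRatClass (ComplexPoints (fiberOver π t)) 2 v with hc
  have hcW : c ∈ W :=
    (ofRatClass_mem_transportInvariants_iff π 2 hU hrat ⟨t, Set.mem_univ t⟩ hΓ₀le v).2 fun g hg => (hNfix v).1 hv g hg
  let pq02 : ↥(Finset.HasAntidiagonal.antidiagonal 2) := ⟨(0, 2), by simp⟩
  have h02W : A.typeProj 2 pq02 c ∈ W := hWH.typeProj_mem hXt A hcW pq02
  have h02 : A.typeProj 2 pq02 c = 0 := by
    set y := Θ.symm (A.typeProj 2 pq02 c) with hy
    have hyN : y ∈ N.baseChange ℂ := hWN _ h02W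
    -- `y ∈ H^{0,2}` of the rational Hodge structure
    have hpiece : Hs.piece 0 2 = A.ratPiece hXt 2 0 2 :=
      HodgeModel.piece_eq_ratPiece A hXt (realHodgeModel_isHodgeSymmetric exists_isReal_hodgeModel_holds hXt)
        (show 0 + 2 = 2 from rfl)
    have hy02 : y ∈ Hs.piece 0 2 := by
      rw [hpiece, HodgeModel.mem_ratPiece_iff, HodgeModel.complexification_apply, ← ofRatClassBaseChangeEquiv_apply hXt, hy,
        LinearEquiv.apply_symm_apply]
      exact A.typeProj_mem 2 pq02 c
    -- its conjugate lies in `N_ℂ ∩ H^{2,0} = 0`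
    have hconj : HodgeStructure.conj y ∈ N.baseChange ℂ ⊓ Hs.piece 2 0 :=
      ⟨conj_mem_baseChange N hyN, Hs.conj_mem_piece hy02⟩
    rw [hi] at hconj
    have hy0 : y = 0 := by
      rw [← HodgeStructure.conj_conj y, (Submodule.mem_bot ℂ).1 hconj, map_zero]
    rw [← LinearEquiv.apply_symm_apply Θ (A.typeProj 2 pq02 c), ← hy, hy0, map_zero]
  -- ### hence `v ⊗ 1 ∈ F¹`
  rw [HodgeStructure.mem_hodgeClasses_iff, hHs, hodge_F, HodgeModel.mem_ratF_iff, HodgeModel.complexification_ofRat]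
  change A.pullback 2 c ∈ A.hodgeFiltration 2 1
  rw [← A.sum_typeProj 2 c, map_sum]
  refine Submodule.sum_mem _ fun pq _ => ?_
  by_cases hpq : pq = pq02
  · rw [hpq, h02, map_zero]; exact Submodule.zero_mem _
  · have hsum : pq.1.1 + pq.1.2 = 2 := Finset.HasAntidiagonal.mem_antidiagonal.1 pq.2
    have hp : 1 ≤ pq.1.1 := by
      by_contra h0
      apply hpq
      have h1 : pq.1.1 = 0 := by omega
      exact Subtype.ext (Prod.ext h1 (by simp [pq02]; omega))
    exact A.hodgePQ_le_hodgeFiltration hsum hp ((A.mem_typePiece_iff pq _).1 (A.typeProj_mem 2 pq c))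

end Summit.HodgeConjecture.HodgeConjecture.Theorems.Q8SymplecticPowersFiniteOrbitPartHodge

end
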